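import Summits.HodgeConjecture.CorCM.GaloisCyclicSemidirectEightNormPairCoefficients
import Summits.HodgeConjecture.CorCM.CyclotomicFourPNormObstruction
import HarnessLib

/-!
# No `μ₄`-norm pair in `ℤ/p` for `p ≡ 5 (mod 8)` — the purely combinatorial statement

COR-CM (cell `pub-hodgecm2`), binder seat b04 (gen 29), count-neutral claim CYCLIC-SEMIDIRECT-EIGHT-DEGENERATE, part VIIIe.
KERNEL ONLY: theorems; no definition, no named fact, no `sorry`.  `HC_CM` is neither used nor claimed.

Part VIIIc (`CorCM/GaloisCyclicSemidirectEightNormPairIff`) reads part IV backwards: GIVEN a Galois CM field `K` with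
`Gal(K/ℚ) ≅ C_p ⋊ C₈`, `p ≡ 5 (mod 8)`, no `μ₄`-norm pair of `ℤ/p` has a non-constant first sheet.  Here the field is
removed: the statement is about `ℤ/p` alone and so is the proof —
* `det_eq_zero_of_normPair`: the two balance identities of part V give back the norm identity
  `G₀(β)G₀(β⁻¹) − i·G₁(β)G₁(β⁻¹) = 0` at every PRIMITIVE `p`-th root of unity `β` (coefficient of `β^d` constant, `Σ_d β^d = 0`);
* **`forall_normPair_const_of_mod_eight_eq_five'`**: for `p ≡ 5 (mod 8)`, part III's obstruction («`±i` is not a quotient of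
  norms `z ρ(z)` in `ℚ(ζ_{4p})`», `CyclotomicFourP.exists_subfield_rho`) and part I's `sums_eq_zero_of_det_eq_zero'` force
  `G₀(ζ) = 0`, hence (part VIIIa `const_of_sheet_sum_eq_zero`) `k₀` constant.
With parts V–VIIIc: `C_p ⋊ C₈` is GOOD for `p ≡ 5 (mod 8)` BECAUSE `ℤ/p` has no norm pair, and for any other `p` it is
GOOD iff `ℤ/p` has no norm pair (open for `p ∉ {3, 7, 11, 17, 19, 23, 31, 41, 71, 73, 89, 127, …}`).

## References

* [Kubota1965] T. Kubota, *On the field extension by complex multiplication*, Trans. AMS 118 (1965), §4 Lemma 2.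
* [FeinGordonSmith1971] B. Fein, B. Gordon, J. H. Smith, *On the representation of −1 as a sum of two squares in an
  algebraic number field*, J. Number Theory 3 (1971), 310–315.
* [Washington1997] L. C. Washington, *Introduction to Cyclotomic Fields*, 2nd ed., GTM 83, Thm. 2.5.
-/

noncomputable section

open scoped BigOperators

namespace Summit.HodgeConjecture.CorCM.GaloisCyclicSemidirectEight

open Summit.HodgeConjecture.CorCM.CyclotomicFourP (exists_subfield_rho)
open AddChar
open Multiplicative (ofAdd toAdd)

section Arithmetic

variable {p : ℕ} [Fact p.Prime]

/-- **From the balance identities back to the norm identity**: a `μ₄`-norm pair `(k₀, k₁)` of `ℤ/p` satisfies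
`G₀(β)G₀(β⁻¹) − i·G₁(β)G₁(β⁻¹) = 0` at every PRIMITIVE `p`-th root of unity `β` (`Gⱼ(β) = Σ_v i^{kⱼ(v)} β^v`; part V proved
this inside `exists_simple_degenerate_of_normPair`, here it is isolated: the coefficient `R(d) + I(d)·i` of `β^d` is constant
and `Σ_d β^d = 0`). [cite: Kubota1965, §4 Lemma 2] -/
theorem det_eq_zero_of_normPair (hI4 : Complex.I ^ (2 * 2) = 1) (k₀ k₁ : ZMod p → ZMod (2 * 2)) {β : ℂ}
    (hβ : IsPrimitiveRoot β p)
    (hR : ∀ d : ZMod p,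
      (Finset.univ.filter fun v => k₀ v + k₀ (v - d) = 0).card +
            (Finset.univ.filter fun v => k₁ v + k₁ (v - d) = 1).card +
          (Finset.univ.filter fun v => k₀ v + k₀ v = 2).card + (Finset.univ.filter fun v => k₁ v + k₁ v = 3).card =
        (Finset.univ.filter fun v => k₀ v + k₀ v = 0).card + (Finset.univ.filter fun v => k₁ v + k₁ v = 1).card +
            (Finset.univ.filter fun v => k₀ v + k₀ (v - d) = 2).card +
          (Finset.univ.filter fun v => k₁ v + k₁ (v - d) = 3).card)
    (hI : ∀ d : ZMod p,
      (Finset.univ.filter fun v => k₀ v + k₀ (v - d) = 1).card +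
            (Finset.univ.filter fun v => k₁ v + k₁ (v - d) = 2).card +
          (Finset.univ.filter fun v => k₀ v + k₀ v = 3).card + (Finset.univ.filter fun v => k₁ v + k₁ v = 0).card =
        (Finset.univ.filter fun v => k₀ v + k₀ v = 1).card + (Finset.univ.filter fun v => k₁ v + k₁ v = 2).card +
            (Finset.univ.filter fun v => k₀ v + k₀ (v - d) = 3).card +
          (Finset.univ.filter fun v => k₁ v + k₁ (v - d) = 0).card) :
    (∑ v : ZMod p, zmodChar (2 * 2) hI4 (k₀ v) * zmodChar p hβ.pow_eq_one v) *
        (∑ v : ZMod p, zmodChar (2 * 2) hI4 (k₀ v) * zmodChar p hβ.pow_eq_one (-v)) -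
      Complex.I * ((∑ v : ZMod p, zmodChar (2 * 2) hI4 (k₁ v) * zmodChar p hβ.pow_eq_one v) *
        (∑ v : ZMod p, zmodChar (2 * 2) hI4 (k₁ v) * zmodChar p hβ.pow_eq_one (-v))) = 0 := by
  classical
  have hp : p.Prime := Fact.out
  haveI : NeZero p := ⟨hp.ne_zero⟩
  haveI : Fact (1 < p) := ⟨hp.one_lt⟩
  have hαα : Complex.I * Complex.I = -1 := by rw [← pow_two, Complex.I_sq]
  set ψ4 : AddChar (ZMod (2 * 2)) ℂ := zmodChar (2 * 2) hI4 with hψ4_def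
  set ψp : AddChar (ZMod p) ℂ := zmodChar p hβ.pow_eq_one with hψp_def
  -- the coefficients in coordinates
  set a : ZMod (2 * 2) → ℤ := fun s => (if s = 0 then 1 else 0) - (if s = 2 then 1 else 0) with ha_def
  set b : ZMod (2 * 2) → ℤ := fun s => (if s = 1 then 1 else 0) - (if s = 3 then 1 else 0) with hb_def
  have hcardA : ∀ (k : ZMod p → ZMod (2 * 2)) (d : ZMod p), ∑ v, a (k v + k (v - d)) =
      ((Finset.univ.filter fun v => k v + k (v - d) = 0).card : ℤ) -
        ((Finset.univ.filter fun v => k v + k (v - d) = 2).card : ℤ) := fun k d => by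
    simp only [ha_def, Finset.sum_sub_distrib, Finset.sum_boole]
  have hcardB : ∀ (k : ZMod p → ZMod (2 * 2)) (d : ZMod p), ∑ v, b (k v + k (v - d)) =
      ((Finset.univ.filter fun v => k v + k (v - d) = 1).card : ℤ) -
        ((Finset.univ.filter fun v => k v + k (v - d) = 3).card : ℤ) := fun k d => by
    simp only [hb_def, Finset.sum_sub_distrib, Finset.sum_boole]
  have h0 : ∀ (k : ZMod p → ZMod (2 * 2)) (r : ZMod (2 * 2)),
      (Finset.univ.filter fun v => k v + k (v - 0) = r) = (Finset.univ.filter fun v => k v + k v = r) := fun k r => by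
    simp only [sub_zero]
  have hcoef : ∀ d : ZMod p, (∑ v : ZMod p, ψ4 (k₀ v + k₀ (v - d))) - Complex.I * (∑ v : ZMod p, ψ4 (k₁ v + k₁ (v - d))) =
      (((∑ v, a (k₀ v + k₀ (v - d))) + ∑ v, b (k₁ v + k₁ (v - d)) : ℤ) : ℂ) +
        (((∑ v, b (k₀ v + k₀ (v - d))) - ∑ v, a (k₁ v + k₁ (v - d)) : ℤ) : ℂ) * Complex.I := fun d => by
    rw [hψ4_def, sum_psi_eq_coord _ hαα (fun v => k₀ v + k₀ (v - d)), sum_psi_eq_coord _ hαα (fun v => k₁ v + k₁ (v - d))]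
    simp only [ha_def, hb_def, Int.cast_add, Int.cast_sub]
    linear_combination (-((∑ v : ZMod p, ((if k₁ v + k₁ (v - d) = 1 then 1 else 0) -
      (if k₁ v + k₁ (v - d) = 3 then 1 else 0) : ℤ) : ℤ) : ℂ)) * hαα
  -- the balance identities say that this coefficient does not depend on `d`
  have hconst : ∀ d : ZMod p, (∑ v : ZMod p, ψ4 (k₀ v + k₀ (v - d))) - Complex.I * (∑ v : ZMod p, ψ4 (k₁ v + k₁ (v - d))) =
      (∑ v : ZMod p, ψ4 (k₀ v + k₀ (v - 0))) - Complex.I * (∑ v : ZMod p, ψ4 (k₁ v + k₁ (v - 0))) := fun d => by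
    rw [hcoef, hcoef]
    have hRd := hR d
    have hId := hI d
    have e1 : (∑ v, a (k₀ v + k₀ (v - d))) + ∑ v, b (k₁ v + k₁ (v - d)) =
        (∑ v, a (k₀ v + k₀ (v - 0))) + ∑ v, b (k₁ v + k₁ (v - 0)) := by
      simp only [hcardA, hcardB, h0]; omega
    have e2 : (∑ v, b (k₀ v + k₀ (v - d))) - ∑ v, a (k₁ v + k₁ (v - d)) =
        (∑ v, b (k₀ v + k₀ (v - 0))) - ∑ v, a (k₁ v + k₁ (v - 0)) := by
      simp only [hcardA, hcardB, h0]; omega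
    rw [e1, e2]
  -- `Σ_d β^d = 0` (`β ≠ 1` since `p > 1`)
  have hψp1 : ψp ≠ 1 := by
    intro h
    have h1 : ψp 1 = 1 := by rw [h, AddChar.one_apply]
    rw [hψp_def, zmodChar_apply, ZMod.val_one, pow_one] at h1
    exact hβ.ne_one hp.one_lt h1
  rw [sheet_mul_sheet, sheet_mul_sheet, Finset.mul_sum, ← Finset.sum_sub_distrib]
  have e3 : ∀ d : ZMod p, (∑ v : ZMod p, ψ4 (k₀ v + k₀ (v - d))) * ψp d -
      Complex.I * ((∑ v : ZMod p, ψ4 (k₁ v + k₁ (v - d))) * ψp d) =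
      ((∑ v : ZMod p, ψ4 (k₀ v + k₀ (v - 0))) - Complex.I * (∑ v : ZMod p, ψ4 (k₁ v + k₁ (v - 0)))) * ψp d := fun d => by
    rw [← hconst d]; ring
  simp_rw [e3]
  rw [← Finset.mul_sum, AddChar.sum_eq_zero_of_ne_one hψp1, mul_zero]

/-- **NO `μ₄`-NORM PAIR FOR `p ≡ 5 (mod 8)` — the purely combinatorial statement** (no CM field in the hypotheses): if
`p ≡ 5 (mod 8)` then every pair `k₀, k₁ : ℤ/p → ℤ/4` satisfying the two balance identities of part V has `k₀` constant.
Proof: the norm identity at `ζ = e^{2πi/p}` (previous theorem), part III's obstruction «`±i` is not a quotient of norms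
`z ρ(z)` in `ℚ(ζ_{4p})`» (`CyclotomicFourP.exists_subfield_rho`) via part I's `sums_eq_zero_of_det_eq_zero'`, so
`G₀(ζ) = 0`, and part VIIIa's `const_of_sheet_sum_eq_zero`.  Together with parts V–VIIIc: **`C_p ⋊ C₈` is GOOD for
`p ≡ 5 (mod 8)` BECAUSE no norm pair exists, and for every other `p` it is GOOD iff no norm pair exists.**
[cite: Kubota1965, §4 Lemma 2] [cite: FeinGordonSmith1971, pp. 310–315] [cite: Washington1997, Thm. 2.5] -/
theorem forall_normPair_const_of_mod_eight_eq_five' (hp8 : p % 8 = 5) (k₀ k₁ : ZMod p → ZMod 4)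
    (hR : ∀ d : ZMod p,
      (Finset.univ.filter fun v => k₀ v + k₀ (v - d) = 0).card +
            (Finset.univ.filter fun v => k₁ v + k₁ (v - d) = 1).card +
          (Finset.univ.filter fun v => k₀ v + k₀ v = 2).card + (Finset.univ.filter fun v => k₁ v + k₁ v = 3).card =
        (Finset.univ.filter fun v => k₀ v + k₀ v = 0).card + (Finset.univ.filter fun v => k₁ v + k₁ v = 1).card +
            (Finset.univ.filter fun v => k₀ v + k₀ (v - d) = 2).card +
          (Finset.univ.filter fun v => k₁ v + k₁ (v - d) = 3).card)
    (hI : ∀ d : ZMod p,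
      (Finset.univ.filter fun v => k₀ v + k₀ (v - d) = 1).card +
            (Finset.univ.filter fun v => k₁ v + k₁ (v - d) = 2).card +
          (Finset.univ.filter fun v => k₀ v + k₀ v = 3).card + (Finset.univ.filter fun v => k₁ v + k₁ v = 0).card =
        (Finset.univ.filter fun v => k₀ v + k₀ v = 1).card + (Finset.univ.filter fun v => k₁ v + k₁ v = 2).card +
            (Finset.univ.filter fun v => k₀ v + k₀ (v - d) = 3).card +
          (Finset.univ.filter fun v => k₁ v + k₁ (v - d) = 0).card) :
    ∀ v, k₀ v = k₀ 0 := by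
  classical
  have hp : p.Prime := Fact.out
  haveI : NeZero p := ⟨hp.ne_zero⟩
  have hp2 : p ≠ 2 := by rintro rfl; norm_num at hp8
  have hε : (1 : ℤ) = 1 ∨ (1 : ℤ) = -1 := Or.inl rfl
  have hα : Complex.I = ((1 : ℤ) : ℂ) * Complex.I := by push_cast; ring
  have hI4 : Complex.I ^ (2 * 2) = 1 := alpha_pow_four hε hα
  have hζ : IsPrimitiveRoot (Complex.exp (2 * Real.pi * Complex.I / p)) p := Complex.isPrimitiveRoot_exp p hp.ne_zero
  set ψ4 : AddChar (ZMod (2 * 2)) ℂ := zmodChar (2 * 2) hI4 with hψ4_def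
  set ψp : AddChar (ZMod p) ℂ := zmodChar p hζ.pow_eq_one with hψp_def
  -- the norm identity at `ζ`
  have hdet := det_eq_zero_of_normPair hI4 k₀ k₁ hζ hR hI
  -- the standard odd character `χ₀ = ψ_i ⊗ ψ_ζ` of `ℤ/4 × ℤ/p` and the graphs of the sheets
  let χ₀ : AddChar (Additive (Multiplicative (ZMod (2 * 2)) × Multiplicative (ZMod p))) ℂ :=
    { toFun := fun w => ψ4 (toAdd (Additive.toMul w).1) * ψp (toAdd (Additive.toMul w).2)
      map_zero_eq_one' := by simp
      map_add_eq_mul' := fun w w' => by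
        simp only [toMul_add, Prod.fst_mul, Prod.snd_mul, toAdd_mul, map_add_eq_mul]; ring }
  have hχ₀ : ∀ (t : Multiplicative (ZMod (2 * 2))) (x : Multiplicative (ZMod p)),
      χ₀ (Additive.ofMul (t, x)) = ψ4 (toAdd t) * ψp (toAdd x) := fun t x => rfl
  have h1val : (1 : ZMod (2 * 2)).val = 1 := by decide
  have h2val : (2 : ZMod (2 * 2)).val = 2 := by decide
  have hχc : χ₀ (Additive.ofMul (ofAdd (2 : ZMod (2 * 2)), (1 : Multiplicative (ZMod p)))) = -1 := by
    rw [hχ₀, toAdd_ofAdd, toAdd_one, map_zero_eq_one, mul_one, hψ4_def, zmodChar_apply, h2val, Complex.I_sq]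
  have hχq : χ₀ (Additive.ofMul (ofAdd (1 : ZMod (2 * 2)), (1 : Multiplicative (ZMod p)))) = Complex.I := by
    rw [hχ₀, toAdd_ofAdd, toAdd_one, map_zero_eq_one, mul_one, hψ4_def, zmodChar_apply, h1val, pow_one]
  set gr : (ZMod p → ZMod (2 * 2)) → Finset (Multiplicative (ZMod (2 * 2)) × Multiplicative (ZMod p)) := fun k =>
    Finset.univ.map ⟨fun v => (ofAdd (k v), ofAdd v), fun v w h => by simpa using congrArg Prod.snd h⟩ with hgr_def
  have hgr_sum : ∀ (k : ZMod p → ZMod (2 * 2)) (g : Multiplicative (ZMod (2 * 2)) × Multiplicative (ZMod p) → ℂ),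
      ∑ w ∈ gr k, g w = ∑ v : ZMod p, g (ofAdd (k v), ofAdd v) := fun k g => by
    rw [hgr_def, Finset.sum_map]; rfl
  have eS : ∀ k : ZMod p → ZMod (2 * 2), ∑ s ∈ gr k, χ₀ (Additive.ofMul s) = ∑ v : ZMod p, ψ4 (k v) * ψp v := fun k => by
    rw [hgr_sum]; exact Finset.sum_congr rfl fun v _ => by rw [hχ₀, toAdd_ofAdd, toAdd_ofAdd]
  have eSθ : ∀ k : ZMod p → ZMod (2 * 2), ∑ s ∈ gr k, χ₀ (Additive.ofMul (s.1, s.2⁻¹)) =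
      ∑ v : ZMod p, ψ4 (k v) * ψp (-v) := fun k => by
    rw [hgr_sum]; exact Finset.sum_congr rfl fun v _ => by rw [hχ₀, toAdd_ofAdd, toAdd_inv, toAdd_ofAdd]
  have hΔ : (∑ s ∈ gr k₀, χ₀ (Additive.ofMul s)) * (∑ s ∈ gr k₀, χ₀ (Additive.ofMul (s.1, s.2⁻¹))) -
      χ₀ (Additive.ofMul (ofAdd (1 : ZMod (2 * 2)), (1 : Multiplicative (ZMod p)))) *
        ((∑ t ∈ gr k₁, χ₀ (Additive.ofMul t)) * (∑ t ∈ gr k₁, χ₀ (Additive.ofMul (t.1, t.2⁻¹)))) = 0 := by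
    rw [eS, eSθ, eS, eSθ, hχq]
    exact hdet
  -- part III: `±i` is not a quotient of norms; part I: then both sheet sums vanish
  obtain ⟨M, ρ, hM, hρ4, hρp, hN⟩ := exists_subfield_rho hp hp8
  obtain ⟨hA₀, -⟩ := sums_eq_zero_of_det_eq_zero' χ₀ M ρ hM hρ4 hρp hN hχc (gr k₀) (gr k₁) hΔ
  rw [eS] at hA₀
  exact const_of_sheet_sum_eq_zero hp2 hε hα hζ k₀ hA₀

end Arithmetic

end Summit.HodgeConjecture.CorCM.GaloisCyclicSemidirectEight

end
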